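import Literature.NumberTheory.QuadraticForms.HilbertSymbolLocalRepresentation
import HarnessLib

/-!
# Quinary forms over a local field represent zero (Serre IV §2.2 Thm. 6 (iv))

Topic `NumberTheory/QuadraticForms`; namespace `Literature.NumberTheory.QuadraticForms`. Everything
here is proved; continuation of `HilbertSymbolLocalRepresentation.lean` (`K` a number field, `v` a
finite place, `K_v = v.adicCompletion K`).

* `exists_not_isSquare_hilbertSymbol_eq_one` — the kernel of every character `(·, u)_v` of
  `K_vˣ/K_vˣ²` contains a non-square, because `(K_vˣ : K_vˣ²) = 4 |𝒪_v/2𝒪_v| ≥ 4`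
  (`index_square_eq_four_mul_natCard`, O'Meara 63:9; Serre II §3.3 for `ℚ_p`);
* `exists_binary_eq_not_isSquare_mul` — a binary form `⟨a, b⟩` represents at least two square
  classes (Serre's count "`2^{r-1} ≥ 2`" in the proof of Thm. 6);
* `exists_binary_ternary_common` — a binary and a ternary form represent a common `t ∈ K_vˣ`
  (the ternary form misses at most the class `-cde`, `exists_ternary_eq_of_not_isSquare`);
* `exists_quinary_zero` — **Thm. 6 (iv)**: every diagonal form of rank `5` over `K_v` represents
  `0`. This is the local input of Meyer's theorem and of the step `n ≥ 5` of Hasse–Minkowski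
  (Ch. IV §3.2 Thm. 8 (iv), Cor. 2).

## References

* J.-P. Serre, *A Course in Arithmetic*, GTM 7, Springer 1973, Ch. IV §2.2 Thm. 6 (iv) and its
  proof (PDF pp. 36–37); Ch. II §3.3 (square classes of `ℚ_p`). [Serre1973]
* O. T. O'Meara, *Introduction to quadratic forms* (1963), §63A Prop. 63:9, §63B Prop. 63:13.
-/

noncomputable section

open IsDedekindDomain NumberField
open scoped Valued

namespace Literature.NumberTheory.QuadraticForms

section Local

variable (K : Type) [Field K] [NumberField K] (v : HeightOneSpectrum (𝓞 K))

/-! ### At least four square classes: binary forms represent two classes, quinary forms are isotropic -/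

/-- A unit of `K_v` whose underlying element is a square of `K_v` is a square in `K_vˣ`. [folklore] -/
theorem Units.isSquare_of_isSquare_val {F : Type*} [Field F] {t : Fˣ} (h : IsSquare (t : F)) :
    IsSquare t := by
  obtain ⟨r, hr⟩ := h
  have hr0 : r ≠ 0 := by
    rintro rfl
    exact t.ne_zero (by rw [hr, mul_zero])
  exact ⟨Units.mk0 r hr0, Units.ext (by simpa using hr)⟩

/-- **The kernel of `(·, u)_v` contains a non-square** (`u ∈ K_vˣ`): there is a non-square
`k ∈ K_vˣ` with `(k, u)_v = 1`. Indeed `(K_vˣ : K_vˣ²) = 4 |𝒪_v/2𝒪_v| ≥ 4`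
(`index_square_eq_four_mul_natCard`, O'Meara 63:9; for `K = ℚ`: Serre II §3.3), while if every
non-square `k` had `(k, u)_v = -1` then, by bimultiplicativity, the product of two non-squares
would be a square and `K_vˣ/K_vˣ²` would have at most two elements. [cite: Omeara1963, §63A Prop. 63:9] -/
theorem exists_not_isSquare_hilbertSymbol_eq_one {u : v.adicCompletion K} (hu : u ≠ 0) :
    ∃ k : v.adicCompletion K, k ≠ 0 ∧ ¬ IsSquare k ∧ hilbertSymbol (v.adicCompletion K) k u = 1 := by
  by_contra hcon
  have hneg : ∀ k : v.adicCompletion K, k ≠ 0 → ¬ IsSquare k →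
      hilbertSymbol (v.adicCompletion K) k u = -1 := fun k hk hks ↦
    (hilbertSymbol_ne_one_iff k u).1 fun h1 ↦ hcon ⟨k, hk, hks, h1⟩
  set S : Subgroup (v.adicCompletion K)ˣ := Subgroup.square (v.adicCompletion K)ˣ with hS
  -- two non-squares multiply to a square
  have hmul : ∀ t₁ t₂ : (v.adicCompletion K)ˣ, t₁ ∉ S → t₂ ∉ S → t₁ * t₂ ∈ S := by
    intro t₁ t₂ h₁ h₂
    rw [hS, Subgroup.mem_square] at h₁ h₂ ⊢
    have h₁' : ¬ IsSquare (t₁ : v.adicCompletion K) := fun h ↦ h₁ (Units.isSquare_of_isSquare_val h)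
    have h₂' : ¬ IsSquare (t₂ : v.adicCompletion K) := fun h ↦ h₂ (Units.isSquare_of_isSquare_val h)
    apply Units.isSquare_of_isSquare_val
    by_contra h12
    have h := hneg _ (t₁ * t₂).ne_zero (by simpa using h12)
    rw [Units.val_mul, hilbertSymbol_adicCompletion_mul_left K v t₁.ne_zero t₂.ne_zero hu,
      hneg _ t₁.ne_zero h₁', hneg _ t₂.ne_zero h₂'] at h
    norm_num at h
  -- but the index is at least `4`
  have hidx := index_square_eq_four_mul_natCard K v
  haveI := finite_quotient_span_singleton K v (two_ne_zero_integer K v)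
  have hcard : 0 < Nat.card (𝒪[v.adicCompletion K] ⧸
      Ideal.span {(2 : 𝒪[v.adicCompletion K])}) := Nat.card_pos
  haveI : S.FiniteIndex := ⟨by rw [hidx]; omega⟩
  haveI : Finite ((v.adicCompletion K)ˣ ⧸ S) := Subgroup.finite_quotient_of_finiteIndex
  letI : Fintype ((v.adicCompletion K)ˣ ⧸ S) := Fintype.ofFinite _
  have h3 : 2 < Fintype.card ((v.adicCompletion K)ˣ ⧸ S) := by
    rw [← Nat.card_eq_fintype_card]
    change 2 < S.index
    rw [hidx]; omega
  obtain ⟨a, b, c, hab, hac, hbc⟩ := (Fintype.two_lt_card_iff).1 h3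
  -- two distinct non-trivial classes cannot exist
  have key : ∀ x y : (v.adicCompletion K)ˣ ⧸ S, x ≠ 1 → y ≠ 1 → x ≠ y → False := by
    intro x y hx hy hxy
    obtain ⟨t₁, rfl⟩ := QuotientGroup.mk_surjective x
    obtain ⟨t₂, rfl⟩ := QuotientGroup.mk_surjective y
    have h₁ : t₁ ∉ S := fun h ↦ hx ((QuotientGroup.eq_one_iff t₁).2 h)
    have h₂ : t₂ ∉ S := fun h ↦ hy ((QuotientGroup.eq_one_iff t₂).2 h)
    have h12 : (QuotientGroup.mk (t₁ * t₂) : (v.adicCompletion K)ˣ ⧸ S) = 1 :=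
      (QuotientGroup.eq_one_iff _).2 (hmul t₁ t₂ h₁ h₂)
    have h11 : (QuotientGroup.mk (t₁ * t₁) : (v.adicCompletion K)ˣ ⧸ S) = 1 :=
      (QuotientGroup.eq_one_iff _).2 (by rw [hS, Subgroup.mem_square]; exact ⟨t₁, rfl⟩)
    rw [QuotientGroup.mk_mul] at h12 h11
    apply hxy
    calc (QuotientGroup.mk t₁ : (v.adicCompletion K)ˣ ⧸ S)
        = QuotientGroup.mk t₁ * (QuotientGroup.mk t₁ * QuotientGroup.mk t₂) := by rw [h12, mul_one]
      _ = QuotientGroup.mk t₂ := by rw [← mul_assoc, h11, one_mul]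
  by_cases ha1 : a = 1
  · subst ha1
    exact key b c (Ne.symm hab) (Ne.symm hac) hbc
  by_cases hb1 : b = 1
  · subst hb1
    exact key a c ha1 (Ne.symm hbc) hac
  · exact key a b ha1 hb1 hab

/-- **A binary form represents at least two square classes** (the count `2^r - 2^{r-1} ≥ …` in
Serre's proof of Thm. 6 (iv), here from `(K_vˣ : K_vˣ²) ≥ 4`): for `a b x₀ ∈ K_vˣ` some `t`
represented by `⟨a, b⟩` lies outside the class `x₀ K_vˣ²`. If `a ≢ b` mod squares, one of the
represented values `a`, `b` works; if `a ≡ b`, the represented values are the `t` with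
`(t, -1)_v = (a, -1)_v`, among them `a` and `a k` for a non-square `k` with `(k, -1)_v = 1`.
[cite: Serre1973, Ch. IV §2.2 Thm. 6 (proof, (iv))] -/
theorem exists_binary_eq_not_isSquare_mul {a b x₀ : v.adicCompletion K} (ha : a ≠ 0) (hb : b ≠ 0)
    (hx₀ : x₀ ≠ 0) : ∃ t : v.adicCompletion K, t ≠ 0 ∧
      (∃ y z : v.adicCompletion K, a * y ^ 2 + b * z ^ 2 = t) ∧ ¬ IsSquare (t * x₀) := by
  haveI := neZero_two_adicCompletion K v
  have hrepa : ∃ y z : v.adicCompletion K, a * y ^ 2 + b * z ^ 2 = a := ⟨1, 0, by ring⟩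
  by_cases hab : IsSquare (a * b)
  · -- `a ≡ b`: use `a` and `a k`
    obtain ⟨k, hk0, hks, hk1⟩ := exists_not_isSquare_hilbertSymbol_eq_one K v
      (u := (-1 : v.adicCompletion K)) (neg_ne_zero.2 one_ne_zero)
    obtain ⟨s, hs⟩ := hab
    have hs0 : s ≠ 0 := by
      rintro rfl
      exact mul_ne_zero ha hb (by simpa using hs)
    have hrepak : ∃ y z : v.adicCompletion K, a * y ^ 2 + b * z ^ 2 = a * k := by
      rw [exists_binary_eq_iff_hilbertSymbol K v ha hb (mul_ne_zero ha hk0),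
        show -(a * b) = (-1) * s ^ 2 by rw [hs]; ring,
        hilbertSymbol_mul_sq_right _ _ hs0,
        hilbertSymbol_adicCompletion_mul_left K v ha hk0 (neg_ne_zero.2 one_ne_zero), hk1, mul_one,
        show b = a * (s / a) ^ 2 by field_simp; linear_combination hs, hilbertSymbol_mul_sq_right _ _
          (div_ne_zero hs0 ha), hilbertSymbol_self_right ha]
    by_cases h1 : IsSquare (a * x₀)
    · refine ⟨a * k, mul_ne_zero ha hk0, hrepak, fun h2 ↦ hks ?_⟩
      -- `k = (a k x₀)(a x₀) / (a x₀)²`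
      obtain ⟨r, hr⟩ := h1
      obtain ⟨q, hq⟩ := h2
      have hr0 : r ≠ 0 := by
        rintro rfl
        exact mul_ne_zero ha hx₀ (by simpa using hr)
      refine ⟨q / r, ?_⟩
      field_simp
      linear_combination (-k) * hr + hq
    · exact ⟨a, ha, hrepa, h1⟩
  · -- `a ≢ b`: one of `a`, `b` works
    have hrepb : ∃ y z : v.adicCompletion K, a * y ^ 2 + b * z ^ 2 = b := ⟨0, 1, by ring⟩
    by_cases h1 : IsSquare (a * x₀)
    · refine ⟨b, hb, hrepb, fun h2 ↦ hab ?_⟩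
      obtain ⟨r, hr⟩ := h1
      obtain ⟨q, hq⟩ := h2
      refine ⟨r * q / x₀, ?_⟩
      field_simp
      linear_combination (b * x₀) * hr + (r * r) * hq
    · exact ⟨a, ha, hrepa, h1⟩

/-- **A binary and a ternary form over `K_v` represent a common non-zero value** (the heart of
Serre IV §2.2 Thm. 6 (iv) and of the step `n ≥ 5` of Thm. 8): for `a b c d e ∈ K_vˣ` there is
`t ∈ K_vˣ` with `a y² + b z² = t = c p² + d q² + e r²`. The binary form hits a class other than
`-cde` (`exists_binary_eq_not_isSquare_mul`), which the ternary form represents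
(`exists_ternary_eq_of_not_isSquare`). [cite: Serre1973, Ch. IV §2.2 Thm. 6 (iv)] -/
theorem exists_binary_ternary_common {a b c d e : v.adicCompletion K} (ha : a ≠ 0) (hb : b ≠ 0)
    (hc : c ≠ 0) (hd : d ≠ 0) (he : e ≠ 0) :
    ∃ t : v.adicCompletion K, t ≠ 0 ∧ (∃ y z : v.adicCompletion K, a * y ^ 2 + b * z ^ 2 = t) ∧
      ∃ p q r : v.adicCompletion K, c * p ^ 2 + d * q ^ 2 + e * r ^ 2 = t := by
  obtain ⟨t, ht0, hrep, hts⟩ := exists_binary_eq_not_isSquare_mul K v ha hb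
    (x₀ := -(c * d * e)) (neg_ne_zero.2 (mul_ne_zero (mul_ne_zero hc hd) he))
  refine ⟨t, ht0, hrep, exists_ternary_eq_of_not_isSquare K v hc hd he ht0 ?_⟩
  rwa [show -(c * d * e * t) = t * -(c * d * e) by ring]

/-- **Every quadratic form of rank `5` over `K_v` represents `0`** (Serre, *A Course in
Arithmetic*, Ch. IV §2.2 Thm. 6 (iv), for diagonal forms `⟨a₁, …, a₅⟩`, `aᵢ ∈ K_vˣ`, at a finite
place `v` of a number field): write `f = ⟨a₁, a₂⟩ - (-⟨a₃, a₄, a₅⟩)` and take a common value.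
[cite: Serre1973, Ch. IV §2.2 Thm. 6 (iv)] -/
theorem exists_quinary_zero {a₁ a₂ a₃ a₄ a₅ : v.adicCompletion K} (h₁ : a₁ ≠ 0) (h₂ : a₂ ≠ 0)
    (h₃ : a₃ ≠ 0) (h₄ : a₄ ≠ 0) (h₅ : a₅ ≠ 0) :
    ∃ x : Fin 5 → v.adicCompletion K, x ≠ 0 ∧
      a₁ * x 0 ^ 2 + a₂ * x 1 ^ 2 + a₃ * x 2 ^ 2 + a₄ * x 3 ^ 2 + a₅ * x 4 ^ 2 = 0 := by
  obtain ⟨t, ht0, ⟨y, z, hyz⟩, p, q, r, hpqr⟩ := exists_binary_ternary_common K v h₁ h₂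
    (neg_ne_zero.2 h₃) (neg_ne_zero.2 h₄) (neg_ne_zero.2 h₅)
  refine ⟨![y, z, p, q, r], fun h0 ↦ ht0 ?_, ?_⟩
  · have hy : y = 0 := by simpa using congrFun h0 0
    have hz : z = 0 := by simpa using congrFun h0 1
    rw [← hyz, hy, hz]; ring
  · simp only [Matrix.cons_val_zero, Matrix.cons_val_one, Matrix.cons_val]
    linear_combination hyz - hpqr

end Local

end Literature.NumberTheory.QuadraticForms
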